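import Literature.AnabelianGeometry.EtaleTheta.SettingModelChiProp15Quot
import Literature.AnabelianGeometry.EtaleTheta.SettingModelTateProp15Quot
import Literature.AnabelianGeometry.EtaleTheta.SettingModelCuspYCoordKit
import Literature.AnabelianGeometry.EtaleTheta.SettingModelTateKummerDataCusp
import Literature.AnabelianGeometry.EtaleTheta.ThetaCohomologyCuspSectionPoints
import HarnessLib

/-!
# [EtTh] Prop. 1.5 (i)(ii) «= Ẑ·log»: the root predicates `Prop15iQuot` / `Prop15iiQuot` WITNESSED at the CUSPED χ-models
# `modelχ′ p` (stage 1) and `modelχq′ p i j` (stage 2), together with the census predicate `HasThetaTopology` there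

S. Mochizuki, *The étale theta function and its Frobenioid-theoretic manifestations*, Publ. RIMS **45** (2009) [EtTh], §1,
Prop. 1.5 (i)(ii), PRIMS PDF p. 23 (printed 249) [cite: MochizukiEtTh2009, Prop 1.5 (ii) p.23].

Layer L2 of the abc-iut cell, R78 cluster, seat abc-iut-L2-t6 (gen 7), row «PROP15-QUOT FROM A Y-COORDINATE KIT +
INSTANCES», file 5 (cusped twins). PROOF-ONLY (0 definitions). The cusped models of abc-iut-w5-d029 (`modelχ′`, F5c)
and abc-iut-L2-t5/w5-d029 (`modelχq′`, F5qc) carry the SAME `Π^tp_X`, theta quotients and `y`-coordinate kits as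
`modelχ` / `modelχq` (abc-iut-w5-d171's `yCoordKitχ′` / `yCoordKitχq′`, `SettingModelCuspYCoordKit`, field by field), so
the kit laws, `HasThetaTopology` and the identifications TRANSPORT definitionally:

* `hasThetaTopology_modelχ'`, `hasThetaTopology_modelχq'` — abc-iut-L2-t1's census predicate `HasThetaTopology`
  (`ThetaSettingTopology`) at the cusped models (R3 quotient topologies + «(Δ^tp_Y)^Θ compact», same carriers);
* **`prop15iQuot_kummerDataχ'` / `prop15iiQuot_kummerDataχ'`**, `prop15iQuot_kummerDataχ'Sec` / `prop15iiQuot_kummerDataχ'Sec`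
  (abc-iut-w5-d051's cusped section datum), every `Compat` witness — stage 1 with a cusp;
* **`prop15iQuot_kummerDataχq'` / `prop15iiQuot_kummerDataχq'`** (every `i`, even `j`, every `Compat` witness) —
  stage 2 with a cusp;
* census `ThetaSetting.exists_isEtThOrigin_and_isCusp_and_prop15Quot` / `…_stage2`: SOME theta setting of [EtTh]
  origin WITH A CUSP carries a Kummer datum for which both «F¹/F² = Ẑ·log(U)» and «F̈¹/F̈² = Ẑ·log(Ü)» hold at `compat`.
With `SettingModelChiProp15Quot` / `SettingModelTateProp15Quot` this completes the profile «Prop15iQuot ∧ Prop15iiQuot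
WITNESSED at all four R78 χ-models modelχ / modelχ′ / modelχq / modelχq′».
HONEST FRAMING: SEMI-SYNTHETIC models (the cusp is the Tate-twisted `b`-axis, not print's commutator axis) —
consistency / non-vacuity evidence for the typed interface ONLY; nothing of [EtTh] is asserted; typed ≠ proved; no side is
taken on [IUTchIII] Cor. 3.12.
-/

noncomputable section

namespace Literature.AnabelianGeometry.EtaleTheta.SettingModel

open Literature.AnabelianGeometry.SemiGraphs _root_.Function

variable (p : ℕ) [Fact p.Prime]

/-! ### Stage 1 with a cusp: `modelχ′ p` -/

/-- **`HasThetaTopology` HOLDS at the cusped χ-model `modelχ′`** (same `(Π^tp_X)^Θ`, `(Π^tp_X)^ell`, `(Δ^tp_Y)^Θ` as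
`modelχ`; abc-iut-w5-d111's topology facts). [cite: MochizukiEtTh2009, §1 p.12] -/
theorem hasThetaTopology_modelχ' : (ThetaSetting.modelχ' p).HasThetaTopology :=
  ⟨isQuotientMap_toTheta_modelχ p, isQuotientMap_thetaToEll_modelχ p, isCompact_dtpYTheta_modelχ p⟩

/-- **[EtTh] Prop. 1.5 (i) «F¹/F² = Ẑ·log(U)» at `modelχ′`** for every Kummer datum whose `log(U)` is the F6 class.
[cite: MochizukiEtTh2009, Prop 1.5 (i) p.23] -/
theorem prop15iQuot_modelχ'_of_logU_eq (hC : (ThetaSetting.modelχ' p).Compat) {E : (ThetaSetting.modelχ' p).KummerData}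
    (hE : E.logU = (yCoordKitχ' p).logU) : ThetaSetting.Prop15iQuot E hC :=
  (yCoordKitχ' p).prop15iQuot_of_laws hC (hasThetaTopology_modelχ' p) (ThetaSetting.modelχ'_isEtThOrigin p)
    (fun _ hg => yCoordKitχ_chiT_eq_one p hg) (yCoordKitχ_ker_law p) (exists_mem_dtpY_y_eq_modelχ p)
    (bijective_deltaThetaCoordχ p) hE

/-- **[EtTh] Prop. 1.5 (ii) «F̈¹/F̈² = Ẑ·log(Ü)» at `modelχ′`** for every Kummer datum whose `log(Ü)` is the F6 class.
[cite: MochizukiEtTh2009, Prop 1.5 (ii) p.23] -/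
theorem prop15iiQuot_modelχ'_of_logUdd_eq (hC : (ThetaSetting.modelχ' p).Compat) {E : (ThetaSetting.modelχ' p).KummerData}
    (hE : E.logUdd = (yCoordKitχ' p).logUdd) : ThetaSetting.Prop15iiQuot E hC :=
  (yCoordKitχ' p).prop15iiQuot_of_laws hC (hasThetaTopology_modelχ' p) (ThetaSetting.modelχ'_isEtThOrigin p)
    (fun _ hg => yCoordKitχ_chiT_eq_one p hg) ((yCoordKitχ' p).ker_law_Ydd_of_Y (yCoordKitχ_ker_law p))
    (exists_mem_dtpYdd_y_eq_sq_modelχ p) (bijective_deltaThetaCoordχ p) hE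

/-- **Prop. 1.5 (i)-Quot at the cusped F6 data `kummerDataχ′`.** [cite: MochizukiEtTh2009, Prop 1.5 (i) p.23] -/
theorem prop15iQuot_kummerDataχ' (hC : (ThetaSetting.modelχ' p).Compat) :
    ThetaSetting.Prop15iQuot (kummerDataχ' p) hC :=
  prop15iQuot_modelχ'_of_logU_eq p hC rfl

/-- **Prop. 1.5 (ii)-Quot at the cusped F6 data `kummerDataχ′`.** [cite: MochizukiEtTh2009, Prop 1.5 (ii) p.23] -/
theorem prop15iiQuot_kummerDataχ' (hC : (ThetaSetting.modelχ' p).Compat) :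
    ThetaSetting.Prop15iiQuot (kummerDataχ' p) hC :=
  prop15iiQuot_modelχ'_of_logUdd_eq p hC rfl

/-- **Prop. 1.5 (i)-Quot at abc-iut-w5-d051's cusped section datum `kummerDataχ′Sec`** (the datum whose points include
cuspidal ones). [cite: MochizukiEtTh2009, Prop 1.5 (i) p.23] -/
theorem prop15iQuot_kummerDataχ'Sec (hC : (ThetaSetting.modelχ' p).Compat) :
    ThetaSetting.Prop15iQuot (kummerDataχ'Sec p) hC :=
  prop15iQuot_modelχ'_of_logU_eq p hC rfl

/-- **Prop. 1.5 (ii)-Quot at the cusped section datum `kummerDataχ′Sec`.** [cite: MochizukiEtTh2009, Prop 1.5 (ii) p.23] -/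
theorem prop15iiQuot_kummerDataχ'Sec (hC : (ThetaSetting.modelχ' p).Compat) :
    ThetaSetting.Prop15iiQuot (kummerDataχ'Sec p) hC :=
  prop15iiQuot_modelχ'_of_logUdd_eq p hC rfl

/-- **Census (stage 1 WITH A CUSP)**: a theta setting of [EtTh] origin with a cusp carries a Kummer datum for which both
«F¹/F² = Ẑ·log(U)» and «F̈¹/F̈² = Ẑ·log(Ü)» hold at `compat`. [cite: MochizukiEtTh2009, Prop 1.5 (ii) p.23] -/
theorem _root_.Literature.AnabelianGeometry.EtaleTheta.ThetaSetting.exists_isEtThOrigin_and_isCusp_and_prop15Quot :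
    ∃ D : ThetaSetting p, D.IsEtThOrigin ∧ (∃ x : D.Pt, D.IsCusp x) ∧ ∃ E : D.KummerData,
      ThetaSetting.Prop15iQuot E D.compat ∧ ThetaSetting.Prop15iiQuot E D.compat :=
  ⟨ThetaSetting.modelχ' p, ThetaSetting.modelχ'_isEtThOrigin p, exists_isCusp_modelχ' p, kummerDataχ'Sec p,
    prop15iQuot_kummerDataχ'Sec p _, prop15iiQuot_kummerDataχ'Sec p _⟩

/-! ### Stage 2 with a cusp: `modelχq′ p i j` -/

section stage2

variable (i j : ℤ) (hj : Even j)

/-- **`HasThetaTopology` HOLDS at the cusped stage-2 model `modelχq′ p i j`** (same carriers as `modelχq`).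
[cite: MochizukiEtTh2009, §1 p.12] -/
theorem hasThetaTopology_modelχq' : (ThetaSetting.modelχq' p i j hj).HasThetaTopology :=
  ⟨isQuotientMap_toTheta_modelχq p i j hj, isQuotientMap_thetaToEll_modelχq p i j hj,
    isCompact_dtpYTheta_modelχq p i j hj⟩

/-- **[EtTh] Prop. 1.5 (i) «F¹/F² = Ẑ·log(U)» at `modelχq′`** for every Kummer datum whose `log(U)` is the F6q class.
[cite: MochizukiEtTh2009, Prop 1.5 (i) p.23] -/
theorem prop15iQuot_modelχq'_of_logU_eq (hC : (ThetaSetting.modelχq' p i j hj).Compat)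
    {E : (ThetaSetting.modelχq' p i j hj).KummerData} (hE : E.logU = (yCoordKitχq' p i j hj).logU) :
    ThetaSetting.Prop15iQuot E hC :=
  (yCoordKitχq' p i j hj).prop15iQuot_of_laws hC (hasThetaTopology_modelχq' p i j hj)
    (ThetaSetting.modelχq'_isEtThOrigin p i j hj) (fun _ hg => yCoordKitχq_chiT_eq_one p i j hj hg)
    (yCoordKitχq_ker_law p i j hj) (exists_mem_dtpY_y_eq p i j hj) (bijective_deltaThetaCoordχq p i j) hE

/-- **[EtTh] Prop. 1.5 (ii) «F̈¹/F̈² = Ẑ·log(Ü)» at `modelχq′`** for every Kummer datum whose `log(Ü)` is the F6q class.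
[cite: MochizukiEtTh2009, Prop 1.5 (ii) p.23] -/
theorem prop15iiQuot_modelχq'_of_logUdd_eq (hC : (ThetaSetting.modelχq' p i j hj).Compat)
    {E : (ThetaSetting.modelχq' p i j hj).KummerData} (hE : E.logUdd = (yCoordKitχq' p i j hj).logUdd) :
    ThetaSetting.Prop15iiQuot E hC :=
  (yCoordKitχq' p i j hj).prop15iiQuot_of_laws hC (hasThetaTopology_modelχq' p i j hj)
    (ThetaSetting.modelχq'_isEtThOrigin p i j hj) (fun _ hg => yCoordKitχq_chiT_eq_one p i j hj hg)
    ((yCoordKitχq' p i j hj).ker_law_Ydd_of_Y (yCoordKitχq_ker_law p i j hj)) (exists_mem_dtpYdd_y_eq_sq p i j hj)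
    (bijective_deltaThetaCoordχq p i j) hE

/-- **Prop. 1.5 (i)-Quot at the cusped F6q data `kummerDataχq′`.** [cite: MochizukiEtTh2009, Prop 1.5 (i) p.23] -/
theorem prop15iQuot_kummerDataχq' (hC : (ThetaSetting.modelχq' p i j hj).Compat) :
    ThetaSetting.Prop15iQuot (kummerDataχq' p i j hj) hC :=
  prop15iQuot_modelχq'_of_logU_eq p i j hj hC rfl

/-- **Prop. 1.5 (ii)-Quot at the cusped F6q data `kummerDataχq′`.** [cite: MochizukiEtTh2009, Prop 1.5 (ii) p.23] -/
theorem prop15iiQuot_kummerDataχq' (hC : (ThetaSetting.modelχq' p i j hj).Compat) :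
    ThetaSetting.Prop15iiQuot (kummerDataχq' p i j hj) hC :=
  prop15iiQuot_modelχq'_of_logUdd_eq p i j hj hC rfl

include i j hj in
/-- **Census (stage 2 WITH A CUSP)**: a Tate-sheared theta setting of [EtTh] origin with a cusp carries a Kummer datum for
which both identifications hold at `compat`. [cite: MochizukiEtTh2009, Prop 1.5 (ii) p.23] -/
theorem _root_.Literature.AnabelianGeometry.EtaleTheta.ThetaSetting.exists_isEtThOrigin_and_isCusp_and_prop15Quot_stage2 :
    ∃ D : ThetaSetting p, D.IsEtThOrigin ∧ (∃ x : D.Pt, D.IsCusp x) ∧ ∃ E : D.KummerData,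
      ThetaSetting.Prop15iQuot E D.compat ∧ ThetaSetting.Prop15iiQuot E D.compat :=
  ⟨ThetaSetting.modelχq' p i j hj, ThetaSetting.modelχq'_isEtThOrigin p i j hj, exists_isCusp_modelχq' p i j hj,
    kummerDataχq' p i j hj, prop15iQuot_kummerDataχq' p i j hj _, prop15iiQuot_kummerDataχq' p i j hj _⟩

end stage2

end Literature.AnabelianGeometry.EtaleTheta.SettingModel

end
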